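import Summits.CriticalPhenomena.PercolationContinuityZ3.Theorems.PercNearOneGluingNoHeavyLowerTailSahiSunflowerMerge
import Summits.CriticalPhenomena.PercolationContinuityZ3.Theorems.PercNearOneGluingNoHeavyLowerTailSahiSunflowerNullPetals
import Summits.CriticalPhenomena.PercolationContinuityZ3.Theorems.PercNearOneGluingNoHeavyLowerTailSahiSunflowerPetalChain
import Mathlib.Tactic.Linarith
import HarnessLib

/-!
# `NoHeavyLowerTail` (crux stmt-CriticalPhenomena-4575), master-family line P2 (Sahi's algebraic route):
# the PETAL-TRANSFER INDUCTION — every hereditary row-positive class of weights on `Sun m` is Sahi-positive of EVERY order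

Support file (seat `prim-masterthm-p2`, gen 4; `--supports stmt-CriticalPhenomena-4575`); no definition, no named fact, no sorry.  Memo SAHI-ROUTE.md §4.13.

**ENGINE THEOREM** (`sahiPositive_of_hereditary`, every `m`).  Let `Good` be a class of probability weights on `Sun m` such that
(i) `Good ν ⇒ E_m(row) ≥ 0`, (ii) `Good` is stable under the push-forwards along `merge j out` and `merge j (pet x)` (`x ≠ j`).
Then every `Good` weight is Sahi-positive of every order.
Proof (strong induction on the order `n`, inner induction on the number of marked petals):  non-antichain families peel
(`SahiCubeAllOrders.sahiE_setInd_nonneg_of_nested`), absorbing antichains lift (Theorem G, `sahiE_setInd_U_nonneg_of_absI`), and a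
CO-SINGLETON family `(U(S_l))` with witnesses `x` is handled petal by petal: an outside petal `j` lying in every member is merged into the
outside (`sahiE_U_eq_merge_out`); otherwise `j` is added to every member but one, `i₁`, which does not increase `E` (chain lemma, lower orders
by induction), and then `j` is parallel to the witness petal `x i₁` and the family is the pull-back along `merge j (pet (x i₁))`
(`sahiE_U_eq_merge_pet`); the merged weight is again `Good` with `j` null; when every outside petal is null the family is a.e. the sub-row,
`≥ 0` by `sahiE_subrow_nonneg_of_null`.
With `Good := (E_m(row) ≥ 0)` (hereditary by the closed form, file `…SahiSunflowerRowClosedForm`) this is the all-`m` hierarchy theorem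
(file `…SahiSunflowerHierarchy`).
-/

namespace Summit.CriticalPhenomena.PercolationContinuityZ3.Theorems.SahiDeltaSystem

open Finset Function Literature.Combinatorics.Sahi2008

namespace Sun

variable {m : ℕ}

/-- **Transfer along the outside merge**: if `j` lies in every member, the `U`-family is the pull-back of `(U(S_l ∖ j))` along `merge j out`.
[this work] -/
theorem sahiE_U_eq_merge_out (ν : Sun m → ℝ) {n : ℕ} (S : Fin n → Finset (Fin m)) {j : Fin m} (hj : ∀ l, j ∈ S l) :
    sahiE ν n (fun l => setInd (U (S l))) = sahiE (pushWeight ν (merge j out)) n (fun l => setInd (U ((S l).erase j))) := by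
  rw [sahiE_pushWeight_merge]
  congr 1; funext l
  rw [setInd_U_comp_merge_out, Finset.insert_erase (hj l)]

/-- **Transfer along a petal merge**: if `j` and `x` both lie in every member except `S_{i₁}` and in neither case in `S_{i₁}`, the `U`-family is the
pull-back of `(U(S_l ∖ j))` along `merge j (pet x)`. [this work] -/
theorem sahiE_U_eq_merge_pet (ν : Sun m → ℝ) {n : ℕ} (S : Fin n → Finset (Fin m)) {j x : Fin m} {i₁ : Fin n} (hxj : x ≠ j)
    (hjS : ∀ l, l ≠ i₁ → j ∈ S l) (hj1 : j ∉ S i₁) (hxS : ∀ l, l ≠ i₁ → x ∈ S l) (hx1 : x ∉ S i₁) :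
    sahiE ν n (fun l => setInd (U (S l))) = sahiE (pushWeight ν (merge j (pet x))) n (fun l => setInd (U ((S l).erase j))) := by
  rw [sahiE_pushWeight_merge]
  congr 1; funext l
  by_cases hl : l = i₁
  · subst hl
    rw [Finset.erase_eq_of_notMem hj1, setInd_U_comp_merge_pet_of_not_mem j hx1, Finset.erase_eq_of_notMem hj1]
  · rw [setInd_U_comp_merge_pet_of_mem j (Finset.mem_erase.2 ⟨hxj, hxS l hl⟩), Finset.insert_erase (hjS l hl)]

/-- **THE CO-SINGLETON TRANSFER INDUCTION.**  Under a hereditary row-positive class `Good` and lower-order positivity (`hlow`), every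
co-singleton `U`-family `(U(S_l))_{l < n+2}` (witnesses `x`, `x_l ∉ S_l`, `x_l ∈ S_{l'}`) has `E_{n+2} ≥ 0` — by induction on the size `K` of a
set `L` of petals outside which every non-witness petal is null. [this work] -/
theorem coSingleton_nonneg (Good : (Sun m → ℝ) → Prop)
    (hGout : ∀ (ν : Sun m → ℝ) (j : Fin m), (∀ y, 0 ≤ ν y) → ∑ y, ν y = 1 → Good ν → Good (pushWeight ν (merge j out)))
    (hGpet : ∀ (ν : Sun m → ℝ) (j x : Fin m), x ≠ j → (∀ y, 0 ≤ ν y) → ∑ y, ν y = 1 → Good ν → Good (pushWeight ν (merge j (pet x))))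
    (hGrow : ∀ ν : Sun m → ℝ, (∀ y, 0 ≤ ν y) → ∑ y, ν y = 1 → Good ν → 0 ≤ sahiE ν m (fun i => setInd (U (univ.erase i))))
    {n : ℕ}
    (hlow : ∀ ν : Sun m → ℝ, (∀ y, 0 ≤ ν y) → ∑ y, ν y = 1 → Good ν → ∀ k, k ≤ n + 1 → ∀ W : Fin k → Finset (Sun m),
      (∀ i, IsUpperSet ((W i : Finset (Sun m)) : Set (Sun m))) → 0 ≤ sahiE ν k (fun i => setInd (W i))) :
    ∀ (K : ℕ) (ν : Sun m → ℝ), (∀ y, 0 ≤ ν y) → ∑ y, ν y = 1 → Good ν →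
      ∀ (S : Fin (n + 2) → Finset (Fin m)) (x : Fin (n + 2) → Fin m), Function.Injective x → (∀ i, x i ∉ S i) →
        (∀ i l, i ≠ l → x i ∈ S l) → ∀ L : Finset (Fin m), L.card = K → (∀ j, j ∉ L → (∀ i, x i ≠ j) → ν (pet j) = 0) →
          0 ≤ sahiE ν (n + 2) (fun l => setInd (U (S l)))
  | 0, ν, hν0, hν1, hG, S, x, hx, hxS, hxS', L, hL, hnull => by
    have hL0 : L = ∅ := Finset.card_eq_zero.1 hL
    subst hL0
    have hae : sahiE ν (n + 2) (fun l => setInd (U (S l))) = sahiE ν (n + 2) (fun l => setInd (U (univ.erase (x l)))) := by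
      refine sahiE_U_congr_of_null ν fun l i hi => ?_
      rw [Finset.mem_erase]
      by_cases hix : ∃ l', x l' = i
      · obtain ⟨l', rfl⟩ := hix
        by_cases hll' : l' = l
        · subst hll'
          simp only [ne_eq, not_true_eq_false, Finset.mem_univ, and_true, iff_false]
          exact hxS l'
        · constructor
          · intro _; exact ⟨fun h => hll' (hx h), Finset.mem_univ _⟩
          · intro _; exact hxS' l' l hll'
      · push Not at hix
        exact absurd (hnull i (Finset.notMem_empty i) fun l' => hix l') hi
    rw [hae]
    exact sahiE_subrow_nonneg_of_null hν0 hν1 (hGrow ν hν0 hν1 hG) x hx fun j hj => hnull j (Finset.notMem_empty j) hj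
  | K + 1, ν, hν0, hν1, hG, S, x, hx, hxS, hxS', L, hL, hnull => by
    obtain ⟨j, hjL⟩ : L.Nonempty := Finset.card_pos.1 (by omega)
    have hL' : (L.erase j).card = K := by rw [Finset.card_erase_of_mem hjL, hL]; rfl
    by_cases hjx : ∃ i, x i = j
    · -- `j` is a witness petal: drop it from `L`
      refine coSingleton_nonneg Good hGout hGpet hGrow hlow K ν hν0 hν1 hG S x hx hxS hxS' (L.erase j) hL' fun j' hj' hxj' => ?_
      refine hnull j' (fun hj'L => ?_) hxj'
      have hne : j' ≠ j := by
        rintro rfl; obtain ⟨i, hi⟩ := hjx; exact hxj' i hi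
      exact hj' (Finset.mem_erase.2 ⟨hne, hj'L⟩)
    · push Not at hjx
      by_cases hall : ∀ l, j ∈ S l
      · -- transfer along the outside merge
        rw [sahiE_U_eq_merge_out ν S hall]
        refine coSingleton_nonneg Good hGout hGpet hGrow hlow K _ (pushWeight_merge_nonneg hν0 j out)
          (by rw [sum_pushWeight_merge, hν1]) (hGout ν j hν0 hν1 hG) (fun l => (S l).erase j) x hx
          (fun i h => hxS i (Finset.mem_of_mem_erase h)) (fun i l hil => Finset.mem_erase.2 ⟨hjx i, hxS' i l hil⟩) (L.erase j) hL' ?_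
        intro j' hj' hxj'
        by_cases hjj : j' = j
        · subst hjj; exact pushWeight_merge_pet_self ν j' (by simp)
        · rw [pushWeight_merge_pet_of_ne ν j hjj (by simp)]
          exact hnull j' (fun h => hj' (Finset.mem_erase.2 ⟨hjj, h⟩)) hxj'
      · push Not at hall
        obtain ⟨i₁, hi₁⟩ := hall
        -- make `j` parallel to the witness petal `x i₁`
        set S' : Fin (n + 2) → Finset (Fin m) := fun l => if l = i₁ then S l else insert j (S l) with hS'
        have hchain : sahiE ν (n + 2) (fun l => setInd (U (S' l))) ≤ sahiE ν (n + 2) (fun l => setInd (U (S l))) :=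
          sahiE_U_insertAll_le hν0 (hlow ν hν0 hν1 hG) S hi₁
        refine le_trans ?_ hchain
        have hxj1 : x i₁ ≠ j := hjx i₁
        have hjS' : ∀ l, l ≠ i₁ → j ∈ S' l := fun l hl => by simp [hS', hl]
        have hj1' : j ∉ S' i₁ := by simp [hS', hi₁]
        have hxS1 : ∀ l, l ≠ i₁ → x i₁ ∈ S' l := fun l hl => by
          simp only [hS', hl, if_false, Finset.mem_insert]
          exact Or.inr (hxS' i₁ l (Ne.symm hl))
        have hx1' : x i₁ ∉ S' i₁ := by simp [hS', hxS i₁]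
        rw [sahiE_U_eq_merge_pet ν S' hxj1 hjS' hj1' hxS1 hx1']
        refine coSingleton_nonneg Good hGout hGpet hGrow hlow K _ (pushWeight_merge_nonneg hν0 j (pet (x i₁)))
          (by rw [sum_pushWeight_merge, hν1]) (hGpet ν j (x i₁) hxj1 hν0 hν1 hG) (fun l => (S' l).erase j) x hx ?_ ?_ (L.erase j) hL' ?_
        · intro i h
          have h' := Finset.mem_of_mem_erase h
          by_cases hi : i = i₁
          · subst hi
            simp only [hS', if_true] at h'
            exact hxS i h'
          · simp only [hS', hi, if_false, Finset.mem_insert] at h'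
            rcases h' with h' | h'
            · exact hjx i h'
            · exact hxS i h'
        · intro i l hil
          refine Finset.mem_erase.2 ⟨hjx i, ?_⟩
          by_cases hl : l = i₁
          · subst hl
            simp only [hS', if_true]
            exact hxS' i l hil
          · simp only [hS', hl, if_false, Finset.mem_insert]
            exact Or.inr (hxS' i l hil)
        · intro j' hj' hxj'
          by_cases hjj : j' = j
          · subst hjj
            exact pushWeight_merge_pet_self ν j' fun h => hxj' i₁ (pet_injective h)
          · rw [pushWeight_merge_pet_of_ne ν j hjj fun h => hxj' i₁ (pet_injective h)]
            exact hnull j' (fun h => hj' (Finset.mem_erase.2 ⟨hjj, h⟩)) hxj'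

/-- **ENGINE (indicator form).**  Under a hereditary row-positive class `Good`, every family of up-sets of `Sun m` has `E_n ≥ 0` under every
`Good` probability weight, every `n`. [this work] -/
theorem sahiE_setInd_nonneg_of_hereditary (Good : (Sun m → ℝ) → Prop)
    (hGout : ∀ (ν : Sun m → ℝ) (j : Fin m), (∀ y, 0 ≤ ν y) → ∑ y, ν y = 1 → Good ν → Good (pushWeight ν (merge j out)))
    (hGpet : ∀ (ν : Sun m → ℝ) (j x : Fin m), x ≠ j → (∀ y, 0 ≤ ν y) → ∑ y, ν y = 1 → Good ν → Good (pushWeight ν (merge j (pet x))))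
    (hGrow : ∀ ν : Sun m → ℝ, (∀ y, 0 ≤ ν y) → ∑ y, ν y = 1 → Good ν → 0 ≤ sahiE ν m (fun i => setInd (U (univ.erase i)))) :
    ∀ (n : ℕ) (ν : Sun m → ℝ), (∀ y, 0 ≤ ν y) → ∑ y, ν y = 1 → Good ν →
      ∀ W : Fin n → Finset (Sun m), (∀ i, IsUpperSet ((W i : Finset (Sun m)) : Set (Sun m))) → 0 ≤ sahiE ν n (fun i => setInd (W i)) := by
  intro n
  induction n using Nat.strong_induction_on with
  | _ n ih =>
    intro ν hν0 hν1 hG W hW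
    rcases n with _ | _ | k
    · rw [sahiE_zero]
    · rw [sahiE_one_apply]; exact ex_nonneg hν0 fun y => setInd_nonneg _ _
    · have ihk : ∀ W' : Fin (k + 1) → Finset (Sun m), (∀ i, IsUpperSet ((W' i : Finset (Sun m)) : Set (Sun m))) →
          0 ≤ sahiE ν (k + 1) (fun i => setInd (W' i)) := fun W' hW' => ih (k + 1) (by omega) ν hν0 hν1 hG W' hW'
      by_cases hanti : Pairwise fun i j => ¬ W j ⊆ W i
      · obtain ⟨S, hS⟩ := exists_eq_U_of_antichain W hW hanti
        have hWS : (fun i => setInd (W i)) = fun i => setInd (U (S i)) := by funext i; rw [hS]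
        rw [hWS]
        rcases exists_absorber_or_coSingleton S with ⟨p, hp⟩ | ⟨x, hx, hxS, hxS'⟩
        · exact sahiE_setInd_U_nonneg_of_absI hν0 hν1 ((sahiPositive_iff_indicators ν (k + 1)).2 ihk) S hp
        · exact coSingleton_nonneg Good hGout hGpet hGrow (n := k)
            (fun ν' h0' h1' hG' k' hk' W' hW' => ih k' (by omega) ν' h0' h1' hG' W' hW')
            (univ : Finset (Fin m)).card ν hν0 hν1 hG S x hx hxS hxS' univ rfl (fun j hj _ => absurd (Finset.mem_univ j) hj)
      · unfold Pairwise at hanti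
        push Not at hanti
        obtain ⟨i, j, hij, hsub⟩ := hanti
        exact SahiCubeAllOrders.sahiE_setInd_nonneg_of_nested hν0 hν1 ihk W hW hij hsub

/-- **ENGINE THEOREM.**  A hereditary row-positive class of probability weights on `Sun m` is Sahi-positive of EVERY order. [this work] -/
theorem sahiPositive_of_hereditary (Good : (Sun m → ℝ) → Prop)
    (hGout : ∀ (ν : Sun m → ℝ) (j : Fin m), (∀ y, 0 ≤ ν y) → ∑ y, ν y = 1 → Good ν → Good (pushWeight ν (merge j out)))
    (hGpet : ∀ (ν : Sun m → ℝ) (j x : Fin m), x ≠ j → (∀ y, 0 ≤ ν y) → ∑ y, ν y = 1 → Good ν → Good (pushWeight ν (merge j (pet x))))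
    (hGrow : ∀ ν : Sun m → ℝ, (∀ y, 0 ≤ ν y) → ∑ y, ν y = 1 → Good ν → 0 ≤ sahiE ν m (fun i => setInd (U (univ.erase i))))
    {ν : Sun m → ℝ} (hν0 : ∀ y, 0 ≤ ν y) (hν1 : ∑ y, ν y = 1) (hG : Good ν) (n : ℕ) : SahiPositive ν n :=
  (sahiPositive_iff_indicators ν n).2 (sahiE_setInd_nonneg_of_hereditary Good hGout hGpet hGrow n ν hν0 hν1 hG)

end Sun
end Summit.CriticalPhenomena.PercolationContinuityZ3.Theorems.SahiDeltaSystem
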